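import Summits.BirchSwinnertonDyer.BirchSwinnertonDyer.Theorems.BiquadraticEisensteinDescentHeegnerTwistCouplingInSupplySqrtTwoLadder
import HarnessLib

set_option linter.dupNamespace false -- `Summit.BirchSwinnertonDyer.BirchSwinnertonDyer.Theorems.…` (summit = sub)
set_option autoImplicit false

/-!
# Crux `HeegnerTwistCouplingInSupply` (stmt-BirchSwinnertonDyer-21381) — card `sqrt2-isogeny-heegner-pin`: the OTHER member of each
# isogeny class, `W = B_{−2p} : y² = x³ − 8p x² + 8p² x` (`2`-isogenous to `B_p`, `j = 8000`), `p ≡ 5 (mod 8)` — CELL-5′ (UNCONDITIONAL)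
# and the corners T_A′ / generic rung′ / row rung′ modulo Burungale–Tian + Deuring–Hecke

Route `BiquadraticEisensteinDescent` (cell `pub/bsd-wall`, width seat `bsd-wall-cm-bed-w1` g10; `--supports` 21381, helper). The `j = 8000`
family `B_n = ⟨0, 4n, 0, 2n², 0⟩` is closed under the explicit `2`-isogeny: `B_n′ = ⟨0, −8n, 0, 8n², 0⟩ = B_{−2n}`. The crux quantifies over
curves `W`, so the member `B_{−2p}` (root number `−1` like `B_p`; card: "the isogenous `B_{−2p}`, `Δ = 2¹⁵p⁶`, is the other `ε = −1` member")
is a separate instance; its Heegner twists are `B_{−2p}^{(−ℓq₀)} = ⟨0, 8m, 0, 8m², 0⟩ = B_{2m} = (B_{−m})′` with `m = p·ℓ·q₀`, whose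
descent pair is `S(8m, 8m²)` (the `φ`-set of `B_{−m}`, `…SqrtTwoCell.mem_twoIsogenySelmerGroup_phi`) and `S(−16m, 32m²)` (new here; the
same `(2/r) = −1` law with `α² − 4β = 256 − 128 = 2·8²`, negative classes over `ℝ`). Everything else is as for `B_p` (`…SqrtTwoCorner`,
`…SqrtTwoLadder`, `…SqrtTwoLadderRows`), whose pins, witness fields and class-number certificates are reused by name.

* §1 CELL-5′: `S(−16m, 32m²) ⊆ {1, 2}`, ★ `rank_eq_zero_and_sha_two_dual`, `selmerCorank_two_dual_eq_zero` for `⟨0, 8m, 0, 8m², 0⟩`,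
  `m > 0` square-free with all prime factors `≡ ±3 (mod 8)` — UNCONDITIONAL;
* §2 `L_one_ne_zero_dual` (`j = 8000`, `HasCM`, Burungale–Tian at `2`, Deuring–Hecke);
* §3 `B_{−2p}`: `Δ = 2¹⁵p⁶` for the `ℤ`-model, good reduction away from `2p`, support of `N(B_{−2p}) ⊆ {2, p}`, `HasCM`, the twist literal;
* §4 ★★ `cruxOnBdualCorner_of_two_facts` (T_A′: every prime `p ≡ 5 (mod 8)`, `p ≡ ±2 (mod 5)`), ★ `cruxOnBdualCornerPartner_of_two_facts`
  (generic rung′: partner `q₀ ≡ 5 (mod 8)`, `(q₀/p) = −1`, `p ≥ P(q₀)`), ★ `cruxOnBdualCornerRow_of_two_facts` (row rung′, Cohen count) —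
  the CONCLUSION of crux 21381 for `W = B_{−2p}`, modulo Burungale–Tian + Deuring–Hecke ONLY.

HONEST FRAMING: typed sub-corner rungs on one CM family; the crux (all CM `W`; residual C⁺) and BSD are NOT proved by any of this. THEOREMS ONLY.
-/

noncomputable section

open scoped Classical NumberField

namespace Summit.BirchSwinnertonDyer.BirchSwinnertonDyer.Theorems.BiquadraticEisensteinDescentHeegnerTwistCouplingInSupplySqrtTwoDual

open _root_.WeierstrassCurve Literature.NumberTheory.EllipticCurves Literature.NumberTheory.EllipticCurves.HeathBrown1994.Families
open Literature.NumberTheory.QuadraticFields.Quadratic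
open IsDedekindDomain Rat.HeightOneSpectrum
open Summit.BirchSwinnertonDyer.BirchSwinnertonDyer.Theorems.GoldfeldGoodTwists (mordellWeilRank_congr forall_mem_sha_two_congr)
open Summit.BirchSwinnertonDyer.BirchSwinnertonDyer.Theorems.BiquadraticEisensteinDescentHeegnerTwistCouplingInSupplySqrtTwoCell
open Summit.BirchSwinnertonDyer.BirchSwinnertonDyer.Theorems.BiquadraticEisensteinDescentHeegnerTwistCouplingInSupplySqrtTwoCorner
open Summit.BirchSwinnertonDyer.BirchSwinnertonDyer.Theorems.BiquadraticEisensteinDescentHeegnerTwistCouplingInSupplySqrtTwoPin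
open Summit.BirchSwinnertonDyer.BirchSwinnertonDyer.Theorems.BiquadraticEisensteinDescentHeegnerTwistCouplingInSupplySqrtTwoLadder
open Summit.BirchSwinnertonDyer.BirchSwinnertonDyer.Theorems.BiquadraticEisensteinDescentHeegnerTwistCouplingInSupplyPartnerLadder

/-! ## §1 CELL-5′: the descent pair of `B_{2m} = ⟨0, 8m, 0, 8m², 0⟩` -/

section Cell

variable {m : ℤ}

/-- An odd prime dividing a divisor `d` of `32 m²` divides `m`. [folklore] -/
theorem dvd_of_prime_dvd_of_dvd_thirtytwo_mul_sq {r : ℕ} (hr : r.Prime) (hr2 : r ≠ 2) {d : ℤ}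
    (hrd : (r : ℤ) ∣ d) (hdb : d ∣ 32 * m ^ 2) : (r : ℤ) ∣ m := by
  have hrZ : Prime (r : ℤ) := Nat.prime_iff_prime_int.mp hr
  rcases hrZ.dvd_or_dvd (hrd.trans hdb) with h | h
  · exact absurd (h.trans ⟨1, by norm_num⟩ : (r : ℤ) ∣ (2 : ℤ) ^ 5) (not_dvd_two_pow_of_odd_prime hr hr2)
  · exact hrZ.dvd_of_dvd_pow h

/-- **`S(−16m, 32m²) ⊆ {1, 2}`** — the descent on the divisors of `a² − 4b = 32m²` for `B_{2m} = ⟨0, 8m, 0, 8m², 0⟩` (its `φ`-set), for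
`m > 0` square-free with every prime factor `≡ ±3 (mod 8)`: an odd prime `r ∣ d` gives reduced discriminant `2·(8m/r)²`, a non-residue;
negative classes have no real point (all coefficients `< 0`). [cite: SilvermanAEC2009, Prop. X.4.9] -/
theorem mem_twoIsogenySelmerGroup_dual_phi (hm0 : 0 < m) (hm : Squarefree m)
    (hm8 : ∀ r : ℕ, r.Prime → (r : ℤ) ∣ m → r % 8 = 3 ∨ r % 8 = 5) {d : ℤ}
    (h : d ∈ twoIsogenySelmerGroup (-16 * m) (32 * m ^ 2)) : d = 1 ∨ d = 2 := by
  have hb : (32 * m ^ 2 : ℤ) ≠ 0 := by positivity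
  obtain ⟨hsq, hdvd, hloc⟩ := (mem_twoIsogenySelmerGroup_iff hb).mp h
  by_cases hodd : ∃ r : ℕ, r.Prime ∧ r ≠ 2 ∧ (r : ℤ) ∣ d
  · obtain ⟨r, hr, hr2, hrd⟩ := hodd
    exfalso
    haveI : Fact r.Prime := ⟨hr⟩
    have hrm : (r : ℤ) ∣ m := dvd_of_prime_dvd_of_dvd_thirtytwo_mul_sq hr hr2 hrd hdvd
    exact not_isSoluble_padic_of_prime_factor (hm8 r hr hrm) (α := -16) (β := 32) (c := 8) (by norm_num)
      (by simpa using not_dvd_two_pow_of_odd_prime hr hr2 (k := 3)) hm hrm hsq hrd hdvd (hloc.2 r)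
  · push Not at hodd
    have habs := natAbs_eq_one_or_two_of_squarefree hsq fun q hq hqd => by
      by_contra hq2
      exact hodd q hq hq2 hqd
    rcases Int.natAbs_eq d with hpos | hneg
    · rcases habs with h1 | h2 <;> omega
    · exfalso
      have hd0 : d < 0 := by rcases habs with h1 | h2 <;> omega
      have hmul : d * (32 * m ^ 2 / d) = 32 * m ^ 2 := Int.mul_ediv_cancel' hdvd
      have hd'0 : 32 * m ^ 2 / d < 0 := by
        by_contra hq
        push Not at hq
        nlinarith [mul_nonneg (neg_pos.mpr hd0).le hq, mul_pos hm0 hm0]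
      exact not_isSoluble_real_twoIsogenyQuartic_of_neg hd0 hd'0 (by omega) hloc.1

/-- `S′(8m, 8m²) = S(−16m, 32m²)`. [folklore] -/
theorem twoIsogenySelmerGroup'_dual (m : ℤ) :
    twoIsogenySelmerGroup' (8 * m) (8 * m ^ 2) = twoIsogenySelmerGroup (-16 * m) (32 * m ^ 2) := by
  rw [twoIsogenySelmerGroup'_eq]
  congr 1 <;> ring

/-- `b(a² − 4b) = 256 m⁴ ≠ 0` for `(a, b) = (8m, 8m²)`, `m ≠ 0`. [folklore] -/
theorem hab_dual (hm : m ≠ 0) : (8 * m ^ 2 : ℤ) * ((8 * m) ^ 2 - 4 * (8 * m ^ 2)) ≠ 0 := by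
  rw [show (8 * m ^ 2 : ℤ) * ((8 * m) ^ 2 - 4 * (8 * m ^ 2)) = 256 * m ^ 4 by ring]
  exact mul_ne_zero (by norm_num) (pow_ne_zero 4 hm)

/-- The cast literal `E_{8m, 8m²}` is `B_{2m} = ⟨0, 8m, 0, 8m², 0⟩`. [folklore] -/
theorem lit_dual (m : ℤ) :
    (⟨0, ((8 * m : ℤ) : ℚ), 0, ((8 * m ^ 2 : ℤ) : ℚ), 0⟩ : WeierstrassCurve ℚ) = ⟨0, 8 * (m : ℚ), 0, 8 * (m : ℚ) ^ 2, 0⟩ := by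
  ext <;> push_cast <;> rfl

/-- `B_{2m}` is an elliptic curve for `m ≠ 0`. [folklore] -/
theorem isElliptic_dual (hm : m ≠ 0) : (⟨0, 8 * (m : ℚ), 0, 8 * (m : ℚ) ^ 2, 0⟩ : WeierstrassCurve ℚ).IsElliptic := by
  rw [← lit_dual]
  exact isElliptic_mk_of_ne_zero (F := ℚ) (hab_dual hm)

/-- Arithmetic core: `k = 2^{r+2} (n₁ n₂) ≤ 4`, `k > 0` ⇒ `r = 0` and `n₁ = n₂ = 1`. [folklore] -/
private theorem rank_zero_arith {r n₁ n₂ k : ℕ} (hk : k = 2 ^ (r + 2) * (n₁ * n₂)) (hk4 : k ≤ 4)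
    (hkpos : 0 < k) : r = 0 ∧ n₁ = 1 ∧ n₂ = 1 := by
  subst hk
  have hn₁ : 0 < n₁ := Nat.pos_of_ne_zero (by rintro rfl; simp at hkpos)
  have hn₂ : 0 < n₂ := Nat.pos_of_ne_zero (by rintro rfl; simp at hkpos)
  have h2 : 2 ^ (r + 2) ≤ 4 := le_trans (Nat.le_mul_of_pos_right _ (Nat.mul_pos hn₁ hn₂)) hk4
  have hr : r = 0 := by
    by_contra hr
    have h8 : 2 ^ 3 ≤ 2 ^ (r + 2) := Nat.pow_le_pow_right (by norm_num) (by omega)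
    omega
  subst hr
  norm_num at hk4
  refine ⟨rfl, ?_, ?_⟩ <;> nlinarith

/-- ★ **CELL-5′: `rank B_{2m}(ℚ) = 0` and `Ш(B_{2m}/ℚ)[2] = 0`** for `m > 0` square-free with every prime factor `≡ ±3 (mod 8)` — UNCONDITIONAL
(`#S(8m,8m²)·#S(−16m,32m²) ≤ 4` in `2^{dim S + dim S′} = 2^{rank+2}·#Ш(V₀)[Ξ]·#Ш(E)[Ξ]`). [cite: SilvermanAEC2009, Thm. X.4.2(a), Prop. X.4.9] -/
theorem rank_eq_zero_and_sha_two_dual (hm0 : 0 < m) (hm : Squarefree m)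
    (hm8 : ∀ r : ℕ, r.Prime → (r : ℤ) ∣ m → r % 8 = 3 ∨ r % 8 = 5) :
    (⟨0, 8 * (m : ℚ), 0, 8 * (m : ℚ) ^ 2, 0⟩ : WeierstrassCurve ℚ).mordellWeilRank = 0 ∧
      ∀ c ∈ (⟨0, 8 * (m : ℚ), 0, 8 * (m : ℚ) ^ 2, 0⟩ : WeierstrassCurve ℚ).sha, 2 • c = 0 → c = 0 := by
  have hab := hab_dual hm0.ne'
  haveI := isElliptic_halfModel hab
  haveI := isElliptic_mk_of_ne_zero (F := ℚ) hab
  haveI := isElliptic_dual hm0.ne'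
  have key := two_pow_twoIsogenySelmerRank_add_eq hab
  have hS : (twoIsogenySelmerGroup (8 * m) (8 * m ^ 2)).card ≤ 2 :=
    le_trans (Finset.card_le_card fun d hd => by
      have := mem_twoIsogenySelmerGroup_phi hm0 hm hm8 hd
      simp only [Finset.mem_insert, Finset.mem_singleton]
      exact this) (Finset.card_le_two (a := (1 : ℤ)) (b := 2))
  have hS' : (twoIsogenySelmerGroup' (8 * m) (8 * m ^ 2)).card ≤ 2 := by
    rw [twoIsogenySelmerGroup'_dual]
    exact le_trans (Finset.card_le_card fun d hd => by
      have := mem_twoIsogenySelmerGroup_dual_phi hm0 hm hm8 hd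
      simp only [Finset.mem_insert, Finset.mem_singleton]
      exact this) (Finset.card_le_two (a := (1 : ℤ)) (b := 2))
  have h4 : 2 ^ (twoIsogenySelmerRank (8 * m) (8 * m ^ 2) + twoIsogenySelmerRank' (8 * m) (8 * m ^ 2)) ≤ 4 := by
    rw [pow_add, two_pow_twoIsogenySelmerRank_eq_card hab, two_pow_twoIsogenySelmerRank'_eq_card hab]
    exact Nat.mul_le_mul hS hS'
  obtain ⟨hr, h₁, h₂⟩ := rank_zero_arith key h4 (pow_pos two_pos _)
  have hsha := forall_mem_sha_two_smul_eq_zero_of_halfModel (AddSubgroup.eq_bot_of_card_eq _ h₁)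
    (AddSubgroup.eq_bot_of_card_eq _ h₂)
  refine ⟨?_, forall_mem_sha_two_congr (lit_dual m).symm hsha⟩
  rw [← mordellWeilRank_congr (lit_dual m)]
  exact hr

/-- ★ **CELL-5′, corank form: `corank_{ℤ₂} Sel_{2^∞}(B_{2m}/ℚ) = 0`.** The instance argument is `isElliptic_dual`.
[cite: SilvermanAEC2009, Thm. X.4.2(a) and Prop. X.4.9] [cite: Greenberg1999, §1] -/
theorem selmerCorank_two_dual_eq_zero (hm0 : 0 < m) (hm : Squarefree m)
    (hm8 : ∀ r : ℕ, r.Prime → (r : ℤ) ∣ m → r % 8 = 3 ∨ r % 8 = 5)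
    [hE : (⟨0, 8 * (m : ℚ), 0, 8 * (m : ℚ) ^ 2, 0⟩ : WeierstrassCurve ℚ).IsElliptic] :
    (⟨0, 8 * (m : ℚ), 0, 8 * (m : ℚ) ^ 2, 0⟩ : WeierstrassCurve ℚ).selmerCorank 2 = 0 := by
  haveI : Fact (Nat.Prime 2) := ⟨Nat.prime_two⟩
  obtain ⟨hr, hsha⟩ := rank_eq_zero_and_sha_two_dual hm0 hm hm8
  rw [(⟨0, 8 * (m : ℚ), 0, 8 * (m : ℚ) ^ 2, 0⟩ : WeierstrassCurve ℚ).selmerCorank_eq_mordellWeilRank_add_holds 2, hr,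
    (⟨0, 8 * (m : ℚ), 0, 8 * (m : ℚ) ^ 2, 0⟩ : WeierstrassCurve ℚ).shaCorank_eq_zero_of_forall 2 hsha]

end Cell

/-! ## §2 `L(B_{2m}, 1) ≠ 0` on CELL-5′ -/

section LValue

variable {m : ℤ}

/-- The literal `⟨0, 8m, 0, 8m², 0⟩` is `B_{2m}`. [folklore] -/
theorem dual_eq_B (m : ℤ) :
    (⟨0, 8 * (m : ℚ), 0, 8 * (m : ℚ) ^ 2, 0⟩ : WeierstrassCurve ℚ) = ⟨0, 4 * (2 * (m : ℚ)), 0, 2 * (2 * (m : ℚ)) ^ 2, 0⟩ := by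
  ext <;> simp <;> ring

/-- ★ **CELL-5′, `L`-form: `r_an(B_{2m}) = 0` and `L(B_{2m}, 1) ≠ 0`** (same `m`), modulo Burungale–Tian (at `2`) and Deuring–Hecke
(`j(B_{2m}) = 8000`). [cite: BurungaleTian2026, Thm. 1.1] [cite: SilvermanAEC2009, App. C §11, Example 11.3.1] -/
theorem L_one_ne_zero_dual (hBT : burungaleTian_analyticRank_eq_zero_of_selmerCorank_eq_zero_of_hasCM)
    (hH : hasEntireLFunction_of_j_mem_maximalCMJInvariants) (hm0 : 0 < m) (hm : Squarefree m)
    (hm8 : ∀ r : ℕ, r.Prime → (r : ℤ) ∣ m → r % 8 = 3 ∨ r % 8 = 5)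
    [hE : (⟨0, 8 * (m : ℚ), 0, 8 * (m : ℚ) ^ 2, 0⟩ : WeierstrassCurve ℚ).IsElliptic] :
    (⟨0, 8 * (m : ℚ), 0, 8 * (m : ℚ) ^ 2, 0⟩ : WeierstrassCurve ℚ).analyticRank = 0 ∧
      (⟨0, 8 * (m : ℚ), 0, 8 * (m : ℚ) ^ 2, 0⟩ : WeierstrassCurve ℚ).entireLFunction 1 ≠ 0 := by
  haveI : Fact (Nat.Prime 2) := ⟨Nat.prime_two⟩
  have hn : (2 * (m : ℚ)) ≠ 0 := mul_ne_zero two_ne_zero (by exact_mod_cast hm0.ne')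
  haveI hE' : (⟨0, 4 * (2 * (m : ℚ)), 0, 2 * (2 * (m : ℚ)) ^ 2, 0⟩ : WeierstrassCurve ℚ).IsElliptic := isElliptic_Bfam hn
  have hj : (⟨0, 8 * (m : ℚ), 0, 8 * (m : ℚ) ^ 2, 0⟩ : WeierstrassCurve ℚ).j = 8000 := by
    have h := j_B hn
    simp only [← dual_eq_B] at h
    convert h
  have h0 := hBT _ (hasCM_of_j_eq_8000 _ hj) 2 (selmerCorank_two_dual_eq_zero hm0 hm hm8)
  refine ⟨h0, (analyticRank_eq_zero_iff_holds (W := (⟨0, 8 * (m : ℚ), 0, 8 * (m : ℚ) ^ 2, 0⟩ : WeierstrassCurve ℚ))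
    (hH _ ?_)).1 h0⟩
  rw [hj]
  simp [maximalCMJInvariants]

end LValue

/-! ## §3 `B_{−2p} = ⟨0, −8p, 0, 8p², 0⟩`: conductor support, CM, twist literal -/

section Conductor

/-- The `ℤ`-model `⟨0, −8p, 0, 8p², 0⟩` maps to `B_{−2p}`. [folklore] -/
theorem map_BdualInt (p : ℕ) :
    (⟨0, -8 * (p : ℤ), 0, 8 * (p : ℤ) ^ 2, 0⟩ : WeierstrassCurve ℤ).map (Int.castRingHom ℚ) =
      ⟨0, -8 * (p : ℚ), 0, 8 * (p : ℚ) ^ 2, 0⟩ := by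
  ext <;> simp [WeierstrassCurve.map]

/-- `Δ(⟨0, −8p, 0, 8p², 0⟩) = 2¹⁵ p⁶`. [cite: SilvermanAEC2009, III.1 (b₂, b₄, b₆, b₈, Δ)] -/
theorem BdualInt_Δ (p : ℕ) : (⟨0, -8 * (p : ℤ), 0, 8 * (p : ℤ) ^ 2, 0⟩ : WeierstrassCurve ℤ).Δ = 32768 * (p : ℤ) ^ 6 := by
  simp only [WeierstrassCurve.Δ, WeierstrassCurve.b₂, WeierstrassCurve.b₄, WeierstrassCurve.b₆, WeierstrassCurve.b₈]
  ring

/-- A prime `r ∤ 2p` does not divide `2¹⁵ p⁶`. [folklore] -/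
theorem not_dvd_BdualInt_Δ {p r : ℕ} (hr : r.Prime) (hrp : ¬ r ∣ 2 * p) :
    ¬ (r : ℤ) ∣ (⟨0, -8 * (p : ℤ), 0, 8 * (p : ℤ) ^ 2, 0⟩ : WeierstrassCurve ℤ).Δ := by
  rw [BdualInt_Δ]
  intro h
  have h' : r ∣ 32768 * p ^ 6 := by exact_mod_cast h
  rcases (Nat.Prime.dvd_mul hr).mp h' with h2 | hp6
  · exact hrp ((hr.dvd_of_dvd_pow (show r ∣ 2 ^ 15 by simpa using h2)).mul_right p)
  · exact hrp ((hr.dvd_of_dvd_pow hp6).mul_left 2)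

/-- **`B_{−2p}` has good reduction at every prime `r ∤ 2p`.** [cite: SilvermanAEC2009, VII.5 Prop. 5.1(a)] -/
theorem hasGoodReductionAtPrime_Bdual {p r : ℕ} [Fact r.Prime] (hrp : ¬ r ∣ 2 * p) :
    (⟨0, -8 * (p : ℚ), 0, 8 * (p : ℚ) ^ 2, 0⟩ : WeierstrassCurve ℚ).HasGoodReductionAtPrime r := by
  obtain ⟨v, rfl⟩ : ∃ v : HeightOneSpectrum (𝓞 ℚ), (primesEquiv v : ℕ) = r :=
    ⟨primesEquiv.symm ⟨r, Fact.out⟩, by rw [Equiv.apply_symm_apply]⟩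
  rw [← map_BdualInt]
  exact (hasGoodReductionAtPrime_iff_hasGoodReductionAt_ringOfIntegers v _).2
    (hasGoodReductionAt_map_of_not_dvd _ v (not_dvd_BdualInt_Δ Fact.out hrp))

/-- **Every prime divisor of `N(B_{−2p})` is `2` or `p`** (no modularity). [cite: SilvermanATAEC1994, Thm. IV.10.2(a)] -/
theorem eq_two_or_eq_of_prime_dvd_conductorNorm_Bdual {p r : ℕ}
    [(⟨0, -8 * (p : ℚ), 0, 8 * (p : ℚ) ^ 2, 0⟩ : WeierstrassCurve ℚ).IsElliptic]
    (hp : p.Prime) (hr : r.Prime) (h : r ∣ (⟨0, -8 * (p : ℚ), 0, 8 * (p : ℚ) ^ 2, 0⟩ : WeierstrassCurve ℚ).conductorNorm ℤ) :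
    r = 2 ∨ r = p := by
  by_contra hne
  push Not at hne
  have hrp : ¬ r ∣ 2 * p := fun hd => by
    rcases (Nat.Prime.dvd_mul hr).mp hd with h2 | hp'
    · exact hne.1 ((Nat.prime_dvd_prime_iff_eq hr Nat.prime_two).mp h2)
    · exact hne.2 ((Nat.prime_dvd_prime_iff_eq hr hp).mp hp')
  haveI : Fact r.Prime := ⟨hr⟩
  exact not_dvd_conductorNorm_of_hasGoodReductionAtPrime _ (hasGoodReductionAtPrime_Bdual hrp) h

/-- **`B_{−2p}` has complex multiplication** (`j = 8000`). [cite: SilvermanAEC2009, App. C §11, Example 11.3.1] -/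
theorem hasCM_Bdual (p : ℕ) [Fact p.Prime] [hE : (⟨0, -8 * (p : ℚ), 0, 8 * (p : ℚ) ^ 2, 0⟩ : WeierstrassCurve ℚ).IsElliptic] :
    (⟨0, -8 * (p : ℚ), 0, 8 * (p : ℚ) ^ 2, 0⟩ : WeierstrassCurve ℚ).HasCM := by
  have hn : (-(2 * (p : ℚ))) ≠ 0 := neg_ne_zero.mpr (mul_ne_zero two_ne_zero (by exact_mod_cast (Fact.out : p.Prime).ne_zero))
  have e : (⟨0, -8 * (p : ℚ), 0, 8 * (p : ℚ) ^ 2, 0⟩ : WeierstrassCurve ℚ) = ⟨0, 4 * (-(2 * (p : ℚ))), 0, 2 * (-(2 * (p : ℚ))) ^ 2, 0⟩ := by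
    ext <;> simp <;> ring
  haveI hE' : (⟨0, 4 * (-(2 * (p : ℚ))), 0, 2 * (-(2 * (p : ℚ))) ^ 2, 0⟩ : WeierstrassCurve ℚ).IsElliptic := isElliptic_Bfam hn
  have hj : (⟨0, -8 * (p : ℚ), 0, 8 * (p : ℚ) ^ 2, 0⟩ : WeierstrassCurve ℚ).j = 8000 := by
    have h := j_B hn
    simp only [← e] at h
    convert h
  exact hasCM_of_j_eq_8000 _ hj

/-- `B_{−2p}^{(−qℓ)}` is the CELL-5′ literal `B_{2m}` with `m = p·q·ℓ`. [cite: SilvermanAEC2009, X.2 and X.5] -/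
theorem quadraticTwist_Bdual_neg_mul (p q l : ℕ) :
    (⟨0, -8 * (p : ℚ), 0, 8 * (p : ℚ) ^ 2, 0⟩ : WeierstrassCurve ℚ).quadraticTwist ((-((q * l : ℕ) : ℤ) : ℤ) : ℚ) =
      ⟨0, 8 * (((p * q * l : ℕ) : ℤ) : ℚ), 0, 8 * (((p * q * l : ℕ) : ℤ) : ℚ) ^ 2, 0⟩ := by
  rw [quadraticTwist_mk]
  ext <;> push_cast <;> ring

/-- `B_{−2p}^{(−5ℓ)}` is `B_{2m}` with `m = 5pℓ`. [cite: SilvermanAEC2009, X.2 and X.5] -/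
theorem quadraticTwist_Bdual_neg_five_mul (p ℓ : ℕ) :
    (⟨0, -8 * (p : ℚ), 0, 8 * (p : ℚ) ^ 2, 0⟩ : WeierstrassCurve ℚ).quadraticTwist ((-((5 * ℓ : ℕ) : ℤ) : ℤ) : ℚ) =
      ⟨0, 8 * (((5 * p * ℓ : ℕ) : ℤ) : ℚ), 0, 8 * (((5 * p * ℓ : ℕ) : ℤ) : ℚ) ^ 2, 0⟩ := by
  rw [quadraticTwist_mk]
  ext <;> push_cast <;> ring

end Conductor

end Summit.BirchSwinnertonDyer.BirchSwinnertonDyer.Theorems.BiquadraticEisensteinDescentHeegnerTwistCouplingInSupplySqrtTwoDual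

end
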